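import Summits.Parity.GeneralizedHardyLittlewood.Theorems.CosetDecorrelation.Negative.CosetDecorrelationDegenerations

/-!
# `CosetDecorrelation` (stmt-Parity-13317): every exact multiplicative alignment meets a coset in `≤ ⌊√M⌋+1` points

Negative-side (no-go) lemma for the crux `LiouvilleMAD.CosetDecorrelation` (route LiouvilleMAD, rank 2), line lead c5.
The crux bounds `T_j(n,n';c,M) = Σ_{(m,m') ∈ P_j(M)} λ(mn+c) λ(m'n'+c)`, `P_j(M) = {(m,m') ∈ (M,2M]² : m ≡ m' (mod j)}`
(`Negative.pairs`), `j ≥ ⌊√M⌋+1`, by `C·M^{3/4+ϑ}` with `ϑ < 1/4`, for a FIXED shift `c ≠ 0` and all large `M`.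
A refutation must exhibit `|T_j| ≥ M^{1−o(1)}` along `M → ∞`; the only deterministic way to fix the sign of
`λ(mn+c)·λ(m'n'+c)` on a family of pairs, for a completely multiplicative `±1`-valued `λ`, is an exact alignment
`l·(m'n'+c) = k·(mn+c)` with fixed `k, l ≥ 1` (then the product is `λ(k)λ(l)·λ(mn+c)² `).  This file proves that once
`M ≥ c²` (automatic for fixed `c` and large `M`) EVERY such alignment class with `k ≠ l` meets the coset `P_j(M)` in at
most `M / j + 1 ≤ ⌊√M⌋ + 1` points (`alignment_coset_card_le`, `alignment_coset_card_le_sqrt`), so its contribution to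
`T_j` is `≤ ⌊√M⌋ + 1 = o(M^{3/4})` (`abs_alignmentDiagonal_le`).  (The class `k = l`, i.e. `mn = m'n'`, is the
coincidence diagonal, treated in `CosetDecorrelationCoincidenceDiagonal.lean`; the complementary degenerate regime
`j ≤ |c|` is `Negative.aligned_shift`.)  Hence no Ω-mechanism for the crux — and no bias for it — comes from
multiplicative identities: a counterexample would need a power-scale conspiracy of `λ` across `≍ √M` classes.

Proof.  Write the alignment as `A·m' − B·m = E` with `A = l n'`, `B = k n`, `E = (k−l)c`.  If `A = B` then
`m' − m = E/A` is a NONZERO integer of modulus `< |c| ≤ √M < j`, incompatible with `m ≡ m' (mod j)`: the class is empty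
(`align_filter_eq_empty`).  If `A ≠ B`, two solutions on the coset differ by `(A't, B't)`, `A' = A/g`, `B' = B/g`,
`g = gcd(A,B)`, and the two congruences force `j / gcd(j, |A'−B'|) ∣ t`; so the coordinate with the larger step runs in
ONE residue class modulo `L = max(A',B')·j/gcd(j,|A'−B'|) ≥ j` inside `(M,2M]` — at most `M/L + 1 ≤ M/j + 1` points
(`align_card_le_of_lt`, swap symmetry `align_card_swap`).  [folklore]
-/

namespace Summit.Parity.GeneralizedHardyLittlewood.Theorems.CosetDecorrelation.Negative

open Finset

/-- Counting skeleton: a finite set of pairs whose first coordinates lie in `(M,2M]`, determine the pair, and differ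
pairwise by multiples of `L`, has at most `M / L + 1` elements. -/
theorem align_card_le_of_step (M L : ℕ) (S : Finset (ℕ × ℕ))
    (hbox : ∀ p ∈ S, M < p.1 ∧ p.1 ≤ 2 * M)
    (hinj : ∀ p ∈ S, ∀ q ∈ S, p.1 = q.1 → p = q)
    (hstep : ∀ p ∈ S, ∀ q ∈ S, p.1 ≤ q.1 → L ∣ q.1 - p.1) :
    S.card ≤ M / L + 1 := by
  rcases S.eq_empty_or_nonempty with hS | hS
  · simp [hS]
  have himg : (S.image Prod.fst).Nonempty := hS.image _
  set m₀ := (S.image Prod.fst).min' himg with hm₀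
  obtain ⟨p₀, hp₀S, hp₀⟩ : ∃ p₀ ∈ S, p₀.1 = m₀ := by
    have := min'_mem _ himg
    rw [mem_image] at this
    obtain ⟨p₀, hp₀S, hp₀⟩ := this
    exact ⟨p₀, hp₀S, hp₀⟩
  have hmin : ∀ p ∈ S, m₀ ≤ p.1 := fun p hp =>
    min'_le _ _ (mem_image_of_mem Prod.fst hp)
  have hM₀ : M < m₀ := by rw [← hp₀]; exact (hbox p₀ hp₀S).1
  have hdvd : ∀ p ∈ S, L ∣ p.1 - m₀ := fun p hp => by
    rw [← hp₀]; exact hstep p₀ hp₀S p hp (hp₀ ▸ hmin p hp)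
  calc S.card ≤ (range (M / L + 1)).card := by
        apply card_le_card_of_injOn (fun p : ℕ × ℕ => (p.1 - m₀) / L)
        · intro p hp
          rw [mem_coe] at hp
          rw [mem_coe, mem_range]
          have h1 : p.1 - m₀ ≤ M := by have := (hbox p hp).2; omega
          have h2 : (p.1 - m₀) / L ≤ M / L := Nat.div_le_div_right h1
          show (p.1 - m₀) / L < M / L + 1
          omega
        · intro p hp q hq hpq
          rw [mem_coe] at hp hq
          have hp' := Nat.div_mul_cancel (hdvd p hp)
          have hq' := Nat.div_mul_cancel (hdvd q hq)
          have hpq' : (p.1 - m₀) / L = (q.1 - m₀) / L := hpq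
          have h : p.1 - m₀ = q.1 - m₀ := by rw [← hp', ← hq', hpq']
          have hp1 := hmin p hp
          have hq1 := hmin q hq
          exact hinj p hp q hq (by omega)
    _ = M / L + 1 := card_range _

/-- Step lemma for the ordered case `B < A`: two coset solutions of `A·m' − B·m = E` with `m ≤ m̃` differ in the
first coordinate by a multiple of `L = (A/g)·(j / gcd(j, A/g − B/g))`, `g = gcd(A,B)`. -/
theorem align_step_dvd (j A B : ℕ) (E : ℤ) (hB : 0 < B) (hBA : B < A) (p q : ℕ × ℕ)
    (hp : p.1 ≡ p.2 [MOD j]) (hq : q.1 ≡ q.2 [MOD j])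
    (hpE : (A : ℤ) * p.2 - (B : ℤ) * p.1 = E) (hqE : (A : ℤ) * q.2 - (B : ℤ) * q.1 = E) (hle : p.1 ≤ q.1) :
    (A / Nat.gcd A B) * (j / Nat.gcd j (A / Nat.gcd A B - B / Nat.gcd A B)) ∣ q.1 - p.1 := by
  have hA : 0 < A := lt_trans hB hBA
  set g := Nat.gcd A B with hg
  have hg0 : 0 < g := Nat.gcd_pos_of_pos_left _ hA
  set A' := A / g with hA'
  set B' := B / g with hB'
  have hAg : A' * g = A := Nat.div_mul_cancel (Nat.gcd_dvd_left A B)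
  have hBg : B' * g = B := Nat.div_mul_cancel (Nat.gcd_dvd_right A B)
  have hcop : Nat.Coprime A' B' := Nat.coprime_div_gcd_div_gcd hg0
  have hA'0 : 0 < A' := Nat.div_pos (Nat.le_of_dvd hA (Nat.gcd_dvd_left A B)) hg0
  have hB'A' : B' < A' := by
    by_contra hcon
    have hcon' : A' ≤ B' := not_lt.mp hcon
    have : A ≤ B := by
      rw [← hAg, ← hBg]; exact Nat.mul_le_mul_right g hcon'
    omega
  set D := A' - B' with hD
  have hD0 : 0 < D := Nat.sub_pos_of_lt hB'A'
  set h := Nat.gcd j D with hh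
  -- the second coordinates are ordered too
  have hle2 : p.2 ≤ q.2 := by
    by_contra hcon
    have hcon : q.2 < p.2 := not_le.mp hcon
    have h1 : ((q.2 : ℕ) : ℤ) < p.2 := by exact_mod_cast hcon
    have h2 : ((p.1 : ℕ) : ℤ) ≤ q.1 := by exact_mod_cast hle
    have h3 : (A : ℤ) * ((q.2 : ℤ) - p.2) = (B : ℤ) * ((q.1 : ℤ) - p.1) := by linear_combination hqE - hpE
    have h4 : (A : ℤ) * ((q.2 : ℤ) - p.2) < 0 :=
      mul_neg_of_pos_of_neg (by exact_mod_cast hA) (by linarith)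
    have h5 : (0 : ℤ) ≤ (B : ℤ) * ((q.1 : ℤ) - p.1) :=
      mul_nonneg (by positivity) (by linarith)
    linarith
  set u := q.1 - p.1 with hu
  set v := q.2 - p.2 with hv
  have heq : A * v = B * u := by
    have h3 : (A : ℤ) * ((q.2 : ℤ) - p.2) = (B : ℤ) * ((q.1 : ℤ) - p.1) := by linear_combination hqE - hpE
    have : ((A * v : ℕ) : ℤ) = ((B * u : ℕ) : ℤ) := by
      push_cast
      rw [hu, hv, Nat.cast_sub hle2, Nat.cast_sub hle]
      exact h3
    exact_mod_cast this
  have heq' : A' * v = B' * u := by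
    apply Nat.eq_of_mul_eq_mul_right hg0
    rw [mul_assoc, mul_comm v g, ← mul_assoc, hAg, mul_assoc, mul_comm u g, ← mul_assoc, hBg]
    exact heq
  -- A' ∣ u, u = A' t, v = B' t
  have hA'u : A' ∣ u := hcop.dvd_of_dvd_mul_left ⟨v, by rw [heq']⟩
  obtain ⟨t, ht⟩ := hA'u
  have hvt : v = B' * t := by
    apply Nat.eq_of_mul_eq_mul_left hA'0
    rw [heq', ht]; ring
  -- u ≡ v (mod j), hence j ∣ u - v = D * t
  have hq' : p.1 + u ≡ p.2 + v [MOD j] := by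
    have e1 : p.1 + u = q.1 := by omega
    have e2 : p.2 + v = q.2 := by omega
    rw [e1, e2]; exact hq
  have huv : u ≡ v [MOD j] := Nat.ModEq.add_left_cancel hp hq'
  have hvu : v ≤ u := by
    rw [ht, hvt]; exact Nat.mul_le_mul_right t (le_of_lt hB'A')
  have hjdvd : j ∣ u - v := (Nat.modEq_iff_dvd' hvu).1 huv.symm
  have hjdvd' : j ∣ D * t := by
    have e : u - v = D * t := by rw [ht, hvt, hD, Nat.sub_mul]
    rwa [e] at hjdvd
  -- (j / h) ∣ t
  rcases Nat.eq_zero_or_pos j with hj0 | hj0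
  · -- j = 0: then h = D, j / h = 0, and u - v = 0 forces t = 0
    subst hj0
    have ht0 : D * t = 0 := Nat.eq_zero_of_zero_dvd hjdvd'
    have : t = 0 := by
      rcases Nat.mul_eq_zero.1 ht0 with h1 | h1
      · omega
      · exact h1
    rw [ht, this]
    simp
  have hh0 : 0 < h := Nat.gcd_pos_of_pos_left _ hj0
  have hhj : h ∣ j := Nat.gcd_dvd_left j D
  have hhD : h ∣ D := Nat.gcd_dvd_right j D
  have hcop2 : Nat.Coprime (j / h) (D / h) := Nat.coprime_div_gcd_div_gcd hh0
  have H : (j / h) * h ∣ ((D / h) * t) * h := by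
    rwa [Nat.div_mul_cancel hhj, mul_comm (D / h) t, mul_assoc, Nat.div_mul_cancel hhD, mul_comm t D]
  have H' : j / h ∣ (D / h) * t := Nat.dvd_of_mul_dvd_mul_right hh0 H
  have htq : j / h ∣ t := hcop2.dvd_of_dvd_mul_left H'
  show A' * (j / h) ∣ u
  rw [ht]
  exact mul_dvd_mul_left A' htq

/-- Ordered case `B < A`: the coset solutions of `A·m' − B·m = E` number at most `M / j + 1`. -/
theorem align_card_le_of_lt (M j A B : ℕ) (E : ℤ) (hj : 0 < j) (hB : 0 < B) (hBA : B < A) :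
    ((pairs M j).filter (fun p : ℕ × ℕ => (A : ℤ) * p.2 - (B : ℤ) * p.1 = E)).card ≤ M / j + 1 := by
  have hA : 0 < A := lt_trans hB hBA
  set g := Nat.gcd A B with hg
  have hg0 : 0 < g := Nat.gcd_pos_of_pos_left _ hA
  set A' := A / g with hA'
  set B' := B / g with hB'
  have hAg : A' * g = A := Nat.div_mul_cancel (Nat.gcd_dvd_left A B)
  have hBg : B' * g = B := Nat.div_mul_cancel (Nat.gcd_dvd_right A B)
  have hB'A' : B' < A' := by
    by_contra hcon
    have hcon' : A' ≤ B' := not_lt.mp hcon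
    have : A ≤ B := by
      rw [← hAg, ← hBg]; exact Nat.mul_le_mul_right g hcon'
    omega
  set D := A' - B' with hD
  have hD0 : 0 < D := Nat.sub_pos_of_lt hB'A'
  have hDA : D < A' := by
    have hB'0 : 0 < B' := Nat.div_pos (Nat.le_of_dvd hB (Nat.gcd_dvd_right A B)) hg0
    omega
  set h := Nat.gcd j D with hh
  have hh0 : 0 < h := Nat.gcd_pos_of_pos_left _ hj
  have hhj : h ∣ j := Nat.gcd_dvd_left j D
  have hhD : h ∣ D := Nat.gcd_dvd_right j D
  have hhle : h ≤ A' := le_of_lt (lt_of_le_of_lt (Nat.le_of_dvd hD0 hhD) hDA)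
  set L := A' * (j / h) with hL
  have hLj : j ≤ L := by
    calc j = h * (j / h) := by rw [mul_comm, Nat.div_mul_cancel hhj]
      _ ≤ A' * (j / h) := Nat.mul_le_mul_right _ hhle
  have main := align_card_le_of_step M L
    ((pairs M j).filter (fun p : ℕ × ℕ => (A : ℤ) * p.2 - (B : ℤ) * p.1 = E))
    (by
      intro p hp
      simp only [pairs, mem_filter, mem_product, mem_Ioc] at hp
      exact ⟨hp.1.1.1.1, hp.1.1.1.2⟩)
    (by
      intro p hp q hq hpq
      simp only [pairs, mem_filter, mem_product, mem_Ioc] at hp hq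
      have h1 := hp.2
      have h2 := hq.2
      have h3 : (A : ℤ) * p.2 = (A : ℤ) * q.2 := by
        have : ((p.1 : ℕ) : ℤ) = q.1 := by exact_mod_cast hpq
        linear_combination h1 - h2 + (B : ℤ) * this
      have h4 : ((p.2 : ℕ) : ℤ) = q.2 :=
        mul_left_cancel₀ (by exact_mod_cast hA.ne') h3
      exact Prod.ext hpq (by exact_mod_cast h4))
    (by
      intro p hp q hq hle
      simp only [pairs, mem_filter, mem_product, mem_Ioc] at hp hq
      exact align_step_dvd j A B E hB hBA p q hp.1.2 hq.1.2 hp.2 hq.2 hle)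
  calc _ ≤ M / L + 1 := main
    _ ≤ M / j + 1 := by
        have : M / L ≤ M / j := Nat.div_le_div_left hLj hj
        omega

/-- Swap symmetry: exchanging the coordinates turns `A·m' − B·m = E` into `B·m' − A·m = −E`. -/
theorem align_card_swap (M j A B : ℕ) (E : ℤ) :
    ((pairs M j).filter (fun p : ℕ × ℕ => (A : ℤ) * p.2 - (B : ℤ) * p.1 = E)).card
      = ((pairs M j).filter (fun p : ℕ × ℕ => (B : ℤ) * p.2 - (A : ℤ) * p.1 = -E)).card := by
  apply Finset.card_bij (fun p _ => p.swap)
  · intro p hp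
    simp only [pairs, mem_filter, mem_product, Prod.fst_swap, Prod.snd_swap] at hp ⊢
    refine ⟨⟨⟨hp.1.1.2, hp.1.1.1⟩, hp.1.2.symm⟩, ?_⟩
    rw [← hp.2]; ring
  · intro p _ q _ hpq
    exact Prod.swap_injective hpq
  · intro q hq
    refine ⟨q.swap, ?_, Prod.swap_swap q⟩
    simp only [pairs, mem_filter, mem_product, Prod.fst_swap, Prod.snd_swap] at hq ⊢
    refine ⟨⟨⟨hq.1.1.2, hq.1.1.1⟩, hq.1.2.symm⟩, ?_⟩
    linear_combination (-1 : ℤ) * hq.2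

/-- Non-parallel case `A ≠ B` (both positive): at most `M / j + 1` coset solutions of `A·m' − B·m = E`, for EVERY
right-hand side `E`. -/
theorem align_card_le_of_ne (M j A B : ℕ) (E : ℤ) (hj : 0 < j) (hA : 0 < A) (hB : 0 < B) (hAB : A ≠ B) :
    ((pairs M j).filter (fun p : ℕ × ℕ => (A : ℤ) * p.2 - (B : ℤ) * p.1 = E)).card ≤ M / j + 1 := by
  rcases lt_or_gt_of_ne hAB with hlt | hgt
  · rw [align_card_swap]
    exact align_card_le_of_lt M j B A (-E) hj hA hlt
  · exact align_card_le_of_lt M j A B E hj hB hgt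

/-- Parallel case `A = B`: if `E ≠ 0` and `|E| < j·A` there is NO coset solution of `A·m' − A·m = E`
(the lag `m' − m = E/A` is a nonzero integer of modulus `< j`, so `m ≢ m' (mod j)`). -/
theorem align_filter_eq_empty (M j A : ℕ) (E : ℤ) (hA : 0 < A) (hE : E ≠ 0) (hEj : |E| < (j : ℤ) * A) :
    (pairs M j).filter (fun p : ℕ × ℕ => (A : ℤ) * p.2 - (A : ℤ) * p.1 = E) = ∅ := by
  rw [← Finset.not_nonempty_iff_eq_empty]
  rintro ⟨p, hp⟩
  simp only [pairs, mem_filter, mem_product] at hp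
  obtain ⟨⟨_, hmod⟩, hpE⟩ := hp
  have hjd : (j : ℤ) ∣ (p.2 : ℤ) - (p.1 : ℤ) := (Nat.modEq_iff_dvd.1 hmod)
  set x : ℤ := (p.2 : ℤ) - (p.1 : ℤ) with hx
  have hAx : (A : ℤ) * x = E := by rw [hx, mul_sub]; exact hpE
  have hA' : (0 : ℤ) < A := by exact_mod_cast hA
  have habs : (A : ℤ) * |x| < (A : ℤ) * j := by
    have : |E| = (A : ℤ) * |x| := by rw [← hAx, abs_mul, abs_of_pos hA']
    rw [← this, mul_comm]; exact hEj
  have hxj : |x| < j := lt_of_mul_lt_mul_left habs hA'.le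
  have hx0 : x = 0 := Int.eq_zero_of_abs_lt_dvd hjd hxj
  apply hE
  rw [← hAx, hx0, mul_zero]

/-- **Every exact multiplicative alignment meets a coset of the crux's window in at most `M / j + 1` points.**
For a shift `c ≠ 0` with `c² ≤ M`, positive dilations `n, n'`, a modulus `j ≥ ⌊√M⌋ + 1` and fixed multipliers
`k ≠ l` (both `≥ 1`), the pairs `(m,m') ∈ P_j(M)` with `l·(m'n'+c) = k·(mn+c)` — on which
`λ(mn+c)λ(m'n'+c) = λ(k)λ(l)·λ(mn+c)²` has a fixed sign — number at most `M / j + 1`. -/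
theorem alignment_coset_card_le (c : ℤ) (M j n n' k l : ℕ) (hj : Nat.sqrt M + 1 ≤ j) (hn : 0 < n)
    (hn' : 0 < n') (hk : 0 < k) (hl : 0 < l) (hkl : k ≠ l) (hc : c ≠ 0) (hcM : c ^ 2 ≤ M) :
    ((pairs M j).filter (fun p : ℕ × ℕ =>
        (l : ℤ) * ((p.2 : ℤ) * n' + c) = (k : ℤ) * ((p.1 : ℤ) * n + c))).card ≤ M / j + 1 := by
  have hj0 : 0 < j := lt_of_lt_of_le (Nat.succ_pos _) hj
  have hfilter : (pairs M j).filter (fun p : ℕ × ℕ =>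
        (l : ℤ) * ((p.2 : ℤ) * n' + c) = (k : ℤ) * ((p.1 : ℤ) * n + c))
      = (pairs M j).filter (fun p : ℕ × ℕ =>
        ((l * n' : ℕ) : ℤ) * p.2 - ((k * n : ℕ) : ℤ) * p.1 = ((k : ℤ) - l) * c) := by
    apply filter_congr
    intro p _
    push_cast
    constructor <;> intro h <;> linear_combination h
  rw [hfilter]
  by_cases hAB : l * n' = k * n
  · -- parallel case: the class is empty
    have hA : 0 < l * n' := Nat.mul_pos hl hn'
    have hE : ((k : ℤ) - l) * c ≠ 0 := by
      refine mul_ne_zero ?_ hc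
      have : (k : ℤ) ≠ l := by exact_mod_cast hkl
      exact sub_ne_zero.mpr this
    have hcj : |c| < (j : ℤ) := by
      have h1 : c.natAbs ≤ Nat.sqrt M := by
        rw [Nat.le_sqrt']
        have : ((c.natAbs ^ 2 : ℕ) : ℤ) ≤ M := by
          rw [Nat.cast_pow, Int.natCast_natAbs, sq_abs]; exact hcM
        exact_mod_cast this
      have h2 : (c.natAbs : ℤ) < j := by exact_mod_cast (lt_of_le_of_lt h1 hj)
      rwa [Int.natCast_natAbs] at h2
    have hklA : |(k : ℤ) - l| < ((l * n' : ℕ) : ℤ) := by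
      rcases le_total k l with hkl' | hkl'
      · rw [abs_of_nonpos (by linarith [(by exact_mod_cast hkl' : (k : ℤ) ≤ l)])]
        push_cast
        have : (1 : ℤ) ≤ k := by exact_mod_cast hk
        have : (1 : ℤ) ≤ n' := by exact_mod_cast hn'
        nlinarith
      · rw [abs_of_nonneg (by linarith [(by exact_mod_cast hkl' : (l : ℤ) ≤ k)]), hAB]
        push_cast
        have : (1 : ℤ) ≤ l := by exact_mod_cast hl
        have : (1 : ℤ) ≤ n := by exact_mod_cast hn
        nlinarith
    have hEj : |((k : ℤ) - l) * c| < (j : ℤ) * ((l * n' : ℕ) : ℤ) := by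
      rw [abs_mul]
      have hkl0 : 0 < |(k : ℤ) - l| := abs_pos.mpr (sub_ne_zero.mpr (by exact_mod_cast hkl))
      calc |(k : ℤ) - l| * |c| < |(k : ℤ) - l| * j := mul_lt_mul_of_pos_left hcj hkl0
        _ ≤ ((l * n' : ℕ) : ℤ) * j := mul_le_mul_of_nonneg_right hklA.le (by positivity)
        _ = (j : ℤ) * ((l * n' : ℕ) : ℤ) := mul_comm _ _
    rw [← hAB, align_filter_eq_empty M j (l * n') _ hA hE hEj]
    simp
  · exact align_card_le_of_ne M j (l * n') (k * n) _ hj0 (Nat.mul_pos hl hn') (Nat.mul_pos hk hn) hAB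

/-- Window form: at most `⌊√M⌋ + 1` points. -/
theorem alignment_coset_card_le_sqrt (c : ℤ) (M j n n' k l : ℕ) (hj : Nat.sqrt M + 1 ≤ j) (hn : 0 < n)
    (hn' : 0 < n') (hk : 0 < k) (hl : 0 < l) (hkl : k ≠ l) (hc : c ≠ 0) (hcM : c ^ 2 ≤ M) :
    ((pairs M j).filter (fun p : ℕ × ℕ =>
        (l : ℤ) * ((p.2 : ℤ) * n' + c) = (k : ℤ) * ((p.1 : ℤ) * n + c))).card ≤ Nat.sqrt M + 1 := by
  have hj0 : 0 < j := lt_of_lt_of_le (Nat.succ_pos _) hj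
  have h1 := alignment_coset_card_le c M j n n' k l hj hn hn' hk hl hkl hc hcM
  have h2 : M / j ≤ M / (Nat.sqrt M + 1) := Nat.div_le_div_left hj (Nat.succ_pos _)
  have h3 : M / (Nat.sqrt M + 1) ≤ Nat.sqrt M := by
    have hlt : M < (Nat.sqrt M + 1) * (Nat.sqrt M + 1) := Nat.lt_succ_sqrt M
    have : M / (Nat.sqrt M + 1) < Nat.sqrt M + 1 :=
      (Nat.div_lt_iff_lt_mul (Nat.succ_pos _)).2 hlt
    omega
  omega

/-- The aligned part of the crux's sum `T_j(n,n';c,M)` is at most `⌊√M⌋ + 1` in modulus — `o(M^{3/4})`: neither a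
threat to the bound `C·M^{3/4+ϑ}` nor a source of one. -/
theorem abs_alignmentDiagonal_le (c : ℤ) (M j n n' k l : ℕ) (hj : Nat.sqrt M + 1 ≤ j) (hn : 0 < n)
    (hn' : 0 < n') (hk : 0 < k) (hl : 0 < l) (hkl : k ≠ l) (hc : c ≠ 0) (hcM : c ^ 2 ≤ M) :
    |∑ p ∈ (pairs M j).filter (fun p : ℕ × ℕ =>
        (l : ℤ) * ((p.2 : ℤ) * n' + c) = (k : ℤ) * ((p.1 : ℤ) * n + c)), u n c p.1 * u n' c p.2|
      ≤ (Nat.sqrt M : ℝ) + 1 := by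
  have hcard := alignment_coset_card_le_sqrt c M j n n' k l hj hn hn' hk hl hkl hc hcM
  set S := (pairs M j).filter (fun p : ℕ × ℕ =>
        (l : ℤ) * ((p.2 : ℤ) * n' + c) = (k : ℤ) * ((p.1 : ℤ) * n + c)) with hS
  calc |∑ p ∈ S, u n c p.1 * u n' c p.2|
      ≤ ∑ p ∈ S, |u n c p.1 * u n' c p.2| := abs_sum_le_sum_abs _ _
    _ ≤ ∑ _p ∈ S, (1 : ℝ) := by
        apply sum_le_sum
        intro p _
        rw [abs_mul]
        calc |u n c p.1| * |u n' c p.2| ≤ 1 * 1 :=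
              mul_le_mul (abs_u_le_one n c p.1) (abs_u_le_one n' c p.2) (abs_nonneg _) zero_le_one
          _ = 1 := one_mul 1
    _ = (S.card : ℝ) := by simp
    _ ≤ (Nat.sqrt M : ℝ) + 1 := by exact_mod_cast hcard

end Summit.Parity.GeneralizedHardyLittlewood.Theorems.CosetDecorrelation.Negative
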